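import Mathlib.Data.List.Infix
import Mathlib.Data.List.Chain
import Mathlib.Data.List.TakeWhile
import Mathlib.Data.List.Nodup
import Mathlib.Data.Finset.Basic
import HarnessLib

/-!
# Segments of a vertex list inside a vertex set, contraction and expansion

List combinatorics behind the gadget substitution theorem for Hamiltonian-path counts
(`HamiltonianGadgetSubstitution.lean`; method of local replacement, Garey–Johnson 1979, §3.2.2).
For a finite vertex set `VX` (the vertices of a gadget) and a list `l` with distinct entries
(a Hamiltonian path) whose first and last entries lie outside `VX`:

* `IsSeg VX l a xs b` — `xs` is a maximal nonempty run of entries of `l` inside `VX`, immediately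
  preceded by `a ∉ VX` and followed by `b ∉ VX` (a traversal of the gadget from the port `a` to
  the port `b`);
* `contract VX l = l.filter (· ∉ VX)` — the path with the gadget traversals cut out (the
  converse operation `expand` is in `HamiltonianPathExpansion.lean`).

Proved: uniqueness of the segment after `a` / before `b` (`IsSeg.right_unique`,
`IsSeg.left_unique`), two segments sharing an inner vertex coincide (`IsSeg.eq_of_mem_mem`),
every inner vertex lies in a segment (`exists_isSeg_of_mem`), consecutive entries of the
contraction are consecutive in `l` or the two ports of a segment (`infix_contract_iff`).

## References

* M. R. Garey, D. S. Johnson, *Computers and Intractability*, Freeman 1979, §3.2.2.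
-/

namespace Literature.Combinatorics.SimpleGraph

variable {α : Type*}

/-! ### Splitting a list with distinct entries at an entry -/

/-- In a list with distinct entries, the decomposition at an entry is unique. [folklore] -/
theorem split_unique_of_nodup {l p₁ q₁ p₂ q₂ : List α} {a : α} (hl : l.Nodup)
    (h₁ : l = p₁ ++ a :: q₁) (h₂ : l = p₂ ++ a :: q₂) : p₁ = p₂ ∧ q₁ = q₂ := by
  subst h₁
  rcases List.append_eq_append_iff.1 h₂ with ⟨as, rfl, has⟩ | ⟨bs, rfl, hbs⟩
  · rcases as with _ | ⟨c, as⟩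
    · simpa using has
    · simp only [List.cons_append, List.cons.injEq] at has
      obtain ⟨rfl, rfl⟩ := has
      exact absurd hl (by simp [List.nodup_append])
  · rcases bs with _ | ⟨c, bs⟩
    · simpa using hbs.symm
    · simp only [List.cons_append, List.cons.injEq] at hbs
      obtain ⟨rfl, rfl⟩ := hbs
      exact absurd hl (by simp [List.nodup_append])

/-! ### Segments -/

/-- **`xs` is a segment of `l` inside `VX` from `a` to `b`**: `l = … a, xs, b …` with `xs` a
nonempty list of elements of `VX` and `a, b ∉ VX`. [cite: GareyJohnson1979, §3.2.2 (local replacement)] -/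
def IsSeg (VX : Finset α) (l : List α) (a : α) (xs : List α) (b : α) : Prop :=
  (∃ l₁ l₂, l = l₁ ++ a :: (xs ++ b :: l₂)) ∧ xs ≠ [] ∧ (∀ x ∈ xs, x ∈ VX) ∧ a ∉ VX ∧ b ∉ VX

namespace IsSeg

variable {VX : Finset α} {l : List α} {a b a' b' x : α} {xs xs' : List α}

/-- The piece `a, xs, b` is an infix of `l`. [folklore] -/
theorem isInfix (h : IsSeg VX l a xs b) : (a :: (xs ++ [b])) <:+: l := by
  obtain ⟨⟨l₁, l₂, rfl⟩, -⟩ := h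
  exact ⟨l₁, l₂, by simp⟩

/-- The ports and the inner vertices are entries of `l`. [folklore] -/
theorem mem (h : IsSeg VX l a xs b) : a ∈ l ∧ b ∈ l ∧ ∀ x ∈ xs, x ∈ l := by
  have hsub := h.isInfix.subset
  exact ⟨hsub (by simp), hsub (by simp), fun x hx => hsub (by simp [hx])⟩

/-- The run after `a` and the entry after it, read off the decomposition. [folklore] -/
theorem takeWhile_eq [DecidableEq α] (h : IsSeg VX l a xs b) {l₁ l₂ : List α}
    (_hl : l = l₁ ++ a :: (xs ++ b :: l₂)) :
    (xs ++ b :: l₂).takeWhile (· ∈ VX) = xs ∧ (xs ++ b :: l₂).dropWhile (· ∈ VX) = b :: l₂ := by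
  obtain ⟨-, -, hxs, -, hb⟩ := h
  constructor
  · rw [List.takeWhile_append_of_pos (by simpa using hxs), List.takeWhile_cons_of_neg (by simpa using hb),
      List.append_nil]
  · rw [List.dropWhile_append_of_pos (by simpa using hxs), List.dropWhile_cons_of_neg (by simpa using hb)]

/-- **The segment after `a` is unique.** [folklore] -/
theorem right_unique [DecidableEq α] (hl : l.Nodup) (h : IsSeg VX l a xs b) (h' : IsSeg VX l a xs' b') :
    xs = xs' ∧ b = b' := by
  obtain ⟨l₁, l₂, hl₁⟩ := h.1
  obtain ⟨l₁', l₂', hl₁'⟩ := h'.1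
  obtain ⟨-, htail⟩ := split_unique_of_nodup hl hl₁ hl₁'
  have h1 := h.takeWhile_eq hl₁
  have h2 := h'.takeWhile_eq hl₁'
  rw [htail] at h1
  refine ⟨h1.1.symm.trans h2.1, ?_⟩
  have := h1.2.symm.trans h2.2
  simpa using (List.cons.inj this).1

/-- Segments read backwards. [folklore] -/
theorem reverse (h : IsSeg VX l a xs b) : IsSeg VX l.reverse b xs.reverse a := by
  obtain ⟨⟨l₁, l₂, rfl⟩, hne, hxs, ha, hb⟩ := h
  refine ⟨⟨l₂.reverse, l₁.reverse, by simp⟩, by simpa using hne, fun x hx => hxs x (by simpa using hx), hb, ha⟩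

/-- **The segment before `b` is unique.** [folklore] -/
theorem left_unique [DecidableEq α] (hl : l.Nodup) (h : IsSeg VX l a xs b) (h' : IsSeg VX l a' xs' b) :
    xs = xs' ∧ a = a' := by
  have := h.reverse.right_unique (List.nodup_reverse.2 hl) h'.reverse
  exact ⟨List.reverse_injective this.1, this.2⟩

/-- The ports differ from each other and from the inner vertices, which are distinct.
[folklore] -/
theorem nodup_piece (hl : l.Nodup) (h : IsSeg VX l a xs b) : (a :: (xs ++ [b])).Nodup :=
  List.Nodup.sublist h.isInfix.sublist hl

/-- **Two segments with a common inner vertex coincide.** [folklore] -/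
theorem eq_of_mem_mem [DecidableEq α] (hl : l.Nodup) (h : IsSeg VX l a xs b) (h' : IsSeg VX l a' xs' b')
    (hx : x ∈ xs) (hx' : x ∈ xs') : a = a' ∧ xs = xs' ∧ b = b' := by
  suffices key : ∀ {a b a' b' : α} {xs xs' : List α} {l₁ l₂ l₁' l₂' : List α},
      l = l₁ ++ a :: (xs ++ b :: l₂) → l = l₁' ++ a' :: (xs' ++ b' :: l₂') →
      (∀ y ∈ xs, y ∈ VX) → a' ∉ VX → x ∈ xs → x ∈ xs' → ¬ ∃ as, l₁' = l₁ ++ a :: as by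
    obtain ⟨l₁, l₂, hl₁⟩ := h.1
    obtain ⟨l₁', l₂', hl₁'⟩ := h'.1
    have hE := hl₁.symm.trans hl₁'
    rcases List.append_eq_append_iff.1 hE with ⟨as, h1, h2⟩ | ⟨bs, h1, h2⟩
    · rcases as with _ | ⟨c, as⟩
      · rw [List.append_nil] at h1
        subst h1
        simp only [List.nil_append, List.cons.injEq] at h2
        obtain ⟨rfl, -⟩ := h2
        exact ⟨rfl, h.right_unique hl h'⟩
      · simp only [List.cons_append, List.cons.injEq] at h2
        obtain ⟨rfl, -⟩ := h2
        exact (key hl₁ hl₁' h.2.2.1 h'.2.2.2.1 hx hx' ⟨as, h1⟩).elim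
    · rcases bs with _ | ⟨c, bs⟩
      · rw [List.append_nil] at h1
        subst h1
        simp only [List.nil_append, List.cons.injEq] at h2
        obtain ⟨rfl, -⟩ := h2
        exact ⟨rfl, h.right_unique hl h'⟩
      · simp only [List.cons_append, List.cons.injEq] at h2
        obtain ⟨rfl, -⟩ := h2
        have := key hl₁' hl₁ h'.2.2.1 h.2.2.2.1 hx' hx ⟨bs, h1⟩
        exact this.elim
  -- the later segment would have to start inside or after the earlier one: impossible
  intro a b a' b' xs xs' l₁ l₂ l₁' l₂' h1 h2 hxs ha' hx hx' hex
  obtain ⟨as, rfl⟩ := hex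
  rw [h1, List.append_assoc, List.append_cancel_left_eq, List.cons_append, List.cons.injEq] at h2
  obtain ⟨-, h2⟩ := h2
  -- `xs ++ b :: l₂ = as ++ a' :: (xs' ++ b' :: l₂')`
  have hnd : (xs ++ b :: l₂).Nodup := by
    have : l = (l₁ ++ [a]) ++ (xs ++ b :: l₂) := by rw [h1]; simp
    rw [this] at hl
    exact hl.of_append_right
  -- `x ∈ xs'` lies after `a'`, hence in `b :: l₂`, contradicting `x ∈ xs`
  have hxmem : x ∈ b :: l₂ := by
    rcases List.append_eq_append_iff.1 h2 with ⟨cs, -, hcs2⟩ | ⟨ds, hds1, hds2⟩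
    · rw [hcs2]
      simp [hx']
    · rcases ds with _ | ⟨d, ds⟩
      · simp only [List.nil_append, List.cons.injEq] at hds2
        rw [← hds2.2]
        simp [hx']
      · simp only [List.cons_append, List.cons.injEq] at hds2
        obtain ⟨rfl, -⟩ := hds2
        exact absurd (hxs _ (by rw [hds1]; simp)) ha'
  exact (List.disjoint_of_nodup_append hnd) hx hxmem

end IsSeg

/-! ### Every inner vertex lies in a segment -/

/-- The first entry kept by `dropWhile` fails the predicate. [folklore] -/
theorem not_of_dropWhile_eq_cons {p : α → Bool} : ∀ {l r : List α} {b : α},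
    l.dropWhile p = b :: r → p b = false
  | [], _, _, h => by simp at h
  | y :: ys, r, b, h => by
    by_cases hy : p y = true
    · rw [List.dropWhile_cons_of_pos hy] at h
      exact not_of_dropWhile_eq_cons h
    · rw [List.dropWhile_cons_of_neg hy] at h
      obtain ⟨rfl, -⟩ := List.cons.inj h
      simpa using hy

/-- Prepending entries keeps segments. [folklore] -/
theorem IsSeg.append_left {VX : Finset α} {l : List α} {a b : α} {xs : List α} (h : IsSeg VX l a xs b)
    (p : List α) : IsSeg VX (p ++ l) a xs b := by
  obtain ⟨⟨l₁, l₂, rfl⟩, hrest⟩ := h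
  exact ⟨⟨p ++ l₁, l₂, by simp⟩, hrest⟩

/-- In a list with first and last entry outside `VX`, every entry inside `VX` lies in a segment.
[folklore] -/
theorem exists_isSeg_of_mem [DecidableEq α] {VX : Finset α} : ∀ {l : List α} {x : α}, x ∈ l → x ∈ VX →
    (∀ a ∈ l.head?, a ∉ VX) → (∀ b ∈ l.getLast?, b ∉ VX) → ∃ a xs b, IsSeg VX l a xs b ∧ x ∈ xs
  | [], x, hx, _, _, _ => by simp at hx
  | c :: rest, x, hx, hxV, hhead, hlast => by
    have hc : c ∉ VX := hhead c rfl
    have hxc : x ≠ c := fun h => hc (h ▸ hxV)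
    have hxr : x ∈ rest := (List.mem_cons.1 hx).resolve_left hxc
    have hdec : rest = rest.takeWhile (· ∈ VX) ++ rest.dropWhile (· ∈ VX) :=
      List.takeWhile_append_dropWhile.symm
    cases hdrop : rest.dropWhile (· ∈ VX) with
    | nil =>
      exfalso
      have hall : ∀ y ∈ rest, y ∈ VX := fun y hy => by
        simpa using List.dropWhile_eq_nil_iff.1 hdrop y hy
      obtain ⟨r', d, hr'⟩ := (List.eq_nil_or_concat rest).resolve_left (List.ne_nil_of_mem hxr)
      rw [List.concat_eq_append] at hr'
      have hd : d ∉ VX := hlast d (by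
        rw [hr', ← List.cons_append, List.getLast?_append_of_ne_nil _ (List.cons_ne_nil d [])]
        rfl)
      exact hd (hall d (by rw [hr']; simp))
    | cons b rem =>
      have hb : b ∉ VX := by simpa using not_of_dropWhile_eq_cons hdrop
      rw [hdrop] at hdec
      by_cases hxt : x ∈ rest.takeWhile (· ∈ VX)
      · refine ⟨c, rest.takeWhile (· ∈ VX), b, ⟨⟨[], rem, by simpa using congrArg (List.cons c) hdec⟩,
          List.ne_nil_of_mem hxt,
          fun y hy => by simpa using List.mem_takeWhile_imp hy, hc, hb⟩, hxt⟩
      · have hxbr : x ∈ b :: rem := by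
          rw [hdec] at hxr
          exact (List.mem_append.1 hxr).resolve_left hxt
        have hlen : (b :: rem).length < (c :: rest).length := by
          have := congrArg List.length hdec
          simp only [List.length_append, List.length_cons] at this ⊢
          omega
        have hlast' : ∀ d ∈ (b :: rem).getLast?, d ∉ VX := by
          intro d hd
          apply hlast d
          rw [hdec, ← List.cons_append, List.getLast?_append_of_ne_nil _ (List.cons_ne_nil b rem)]
          exact hd
        obtain ⟨a, xs, b', hseg, hxs⟩ :=
          exists_isSeg_of_mem (l := b :: rem) hxbr hxV (fun d hd => by simp at hd; exact hd ▸ hb) hlast'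
        refine ⟨a, xs, b', ?_, hxs⟩
        have := hseg.append_left (c :: rest.takeWhile (· ∈ VX))
        rw [hdec]
        simpa using this
termination_by l => l.length
decreasing_by simp only [List.length_cons] at hlen ⊢; omega

/-! ### Contraction -/

section contract

variable [DecidableEq α]

/-- **Contraction**: delete the entries inside `VX`. [cite: GareyJohnson1979, §3.2.2] -/
def contract (VX : Finset α) (l : List α) : List α :=
  l.filter (· ∉ VX)

variable {VX : Finset α} {l : List α}

/-- Contraction of the empty list. [folklore] -/
@[simp] theorem contract_nil : contract VX ([] : List α) = [] := rfl

/-- Contraction drops a first entry inside `VX`. [folklore] -/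
theorem contract_cons_of_mem {a : α} (h : a ∈ VX) (l : List α) : contract VX (a :: l) = contract VX l := by
  simp [contract, h]

/-- Contraction keeps a first entry outside `VX`. [folklore] -/
theorem contract_cons_of_not_mem {a : α} (h : a ∉ VX) (l : List α) :
    contract VX (a :: l) = a :: contract VX l := by
  simp [contract, h]

/-- Contraction of a concatenation. [folklore] -/
theorem contract_append (l₁ l₂ : List α) : contract VX (l₁ ++ l₂) = contract VX l₁ ++ contract VX l₂ :=
  List.filter_append _ _

/-- A list inside `VX` contracts to nothing. [folklore] -/
theorem contract_eq_nil_of_forall {l : List α} (h : ∀ x ∈ l, x ∈ VX) : contract VX l = [] := by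
  induction l with
  | nil => rfl
  | cons a l ih =>
    rw [contract_cons_of_mem (h a List.mem_cons_self), ih fun x hx => h x (List.mem_cons_of_mem _ hx)]

/-- A list outside `VX` is its own contraction. [folklore] -/
theorem contract_eq_self_of_forall {l : List α} (h : ∀ x ∈ l, x ∉ VX) : contract VX l = l := by
  induction l with
  | nil => rfl
  | cons a l ih =>
    rw [contract_cons_of_not_mem (h a List.mem_cons_self), ih fun x hx => h x (List.mem_cons_of_mem _ hx)]

/-- Contraction keeps distinctness. [folklore] -/
theorem nodup_contract (hl : l.Nodup) : (contract VX l).Nodup := hl.filter _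

/-- The entries of the contraction. [folklore] -/
theorem mem_contract {x : α} : x ∈ contract VX l ↔ x ∈ l ∧ x ∉ VX := by
  simp [contract]

/-- A segment makes its ports consecutive in the contraction. [folklore] -/
theorem IsSeg.infix_contract {a b : α} {xs : List α} (h : IsSeg VX l a xs b) :
    [a, b] <:+: contract VX l := by
  obtain ⟨⟨l₁, l₂, rfl⟩, -, hxs, ha, hb⟩ := h
  refine ⟨contract VX l₁, contract VX l₂, ?_⟩
  rw [contract_append, contract_cons_of_not_mem ha, contract_append, contract_eq_nil_of_forall hxs,
    contract_cons_of_not_mem hb]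
  simp

/-- Consecutive entries outside `VX` stay consecutive in the contraction. [folklore] -/
theorem infix_contract_of_infix {a b : α} (h : [a, b] <:+: l) (ha : a ∉ VX) (hb : b ∉ VX) :
    [a, b] <:+: contract VX l := by
  obtain ⟨l₁, l₂, rfl⟩ := h
  refine ⟨contract VX l₁, contract VX l₂, ?_⟩
  rw [contract_append, contract_append, contract_cons_of_not_mem ha, contract_cons_of_not_mem hb,
    contract_nil]

/-- **Consecutive entries of the contraction** are consecutive in `l` or the two ports of a
segment. [folklore] -/
theorem infix_contract_iff {a b : α} :
    [a, b] <:+: contract VX l ↔ ([a, b] <:+: l ∧ a ∉ VX ∧ b ∉ VX) ∨ ∃ xs, IsSeg VX l a xs b := by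
  constructor
  · rintro ⟨m₁, m₂, hm⟩
    have hm' : l.filter (· ∉ VX) = m₁ ++ a :: b :: m₂ := by rw [contract] at hm; rw [← hm]; simp
    rw [List.filter_eq_append_iff] at hm'
    obtain ⟨k₁, k₂, rfl, hk₁, hk₂⟩ := hm'
    obtain ⟨k₃, k₄, rfl, hk₃, ha, hk₄⟩ := List.filter_eq_cons_iff.1 hk₂
    obtain ⟨k₅, k₆, rfl, hk₅, hb, -⟩ := List.filter_eq_cons_iff.1 hk₄
    simp only [decide_eq_true_eq] at ha hb hk₅
    rcases k₅ with _ | ⟨c, k₅⟩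
    · exact Or.inl ⟨⟨k₁ ++ k₃, k₆, by simp⟩, ha, hb⟩
    · refine Or.inr ⟨c :: k₅, ⟨k₁ ++ k₃, k₆, by simp⟩, by simp, fun x hx => ?_, ha, hb⟩
      simpa using hk₅ x hx
  · rintro (⟨h, ha, hb⟩ | ⟨xs, h⟩)
    · exact infix_contract_of_infix h ha hb
    · exact h.infix_contract

/-- The first entry survives contraction when it is outside `VX`. [folklore] -/
theorem head?_contract {s : α} (hs : l.head? = some s) (hsV : s ∉ VX) : (contract VX l).head? = some s := by
  rcases l with _ | ⟨c, l⟩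
  · simp at hs
  · simp only [List.head?_cons, Option.some.injEq] at hs
    subst hs
    rw [contract_cons_of_not_mem hsV]
    rfl

/-- The last entry survives contraction when it is outside `VX`. [folklore] -/
theorem getLast?_contract {t : α} (ht : l.getLast? = some t) (htV : t ∉ VX) :
    (contract VX l).getLast? = some t := by
  obtain ⟨l', rfl⟩ := List.getLast?_eq_some_iff.1 ht
  rw [contract_append, contract_cons_of_not_mem htV, contract_nil]
  simp

/-- The support of the contraction. [folklore] -/
theorem toFinset_contract : (contract VX l).toFinset = l.toFinset.filter (· ∉ VX) := by
  ext x; simp [contract]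

end contract

end Literature.Combinatorics.SimpleGraph
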